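import Summits.BirchSwinnertonDyer.BirchSwinnertonDyer.Theorems.SmallImageMuTransferMuTransferX9StepTwoLocal
import Literature.NumberTheory.EllipticCurves.IwasawaTwistModPShapiroCores
import Literature.NumberTheory.EllipticCurves.ZpExtensionUnramifiedProofs
import Literature.NumberTheory.GaloisRepresentations.AbsGaloisOuterConj
import Literature.NumberTheory.GaloisRepresentations.AbsIntegersEquiv
import HarnessLib

/-!
# Corestriction — and the inverse Shapiro map `coresShapiro` — preserve "unramified at `v`"
# (per-place, pointwise form): the Galois-side input of (L-ur) of `stub_selmerDualOdd`
# (skeleton v6 of crux 19276 `MuTransferX9`)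

Cell `b2b-bsdres` (X9 prover lineage, GEN 44) serving the K6 route `SmallImageMuTransfer` of cell
`bsd-smallim`. HONEST FRAMING: the cell deletes COMBINATION-SHAPED residual classes of the rank-≤1
BSD formula from PUBLISHED theorems only and TYPES the construction-shaped remainder; this is not
"finishing BSD"; class X9 stays TYPED at class level. `--supports` helper toward the registered stub
`stub_selmerDualOdd` of stmt-BirchSwinnertonDyer-19276 — its local lemma (L-ur) = hypothesis `hLur` of
k6-c2's `SelmerDual.stub_selmerDualOdd_of_local` (p456301): «`loc_v Ψ` is unramified» for the dual test
class `Ψ` built from a fine `y` through `y_n`, `Y = coresShapiro n y_n` (`= Sh⁻¹ y_n`,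
`coresShapiro_eq_symm`) and a `T`-embedding; books nothing, closes nothing; theorems only.

THE STEP `y_n ↦ Y` (k6-c2's route «`Y = cor(ι_* y_n)` ⟹ `Ψ`»): a PER-PLACE, POINTWISE version of the
tree's `Kato2004.coresLe_mem_integralH1` (`IntegralH1Corestriction.lean`, all `v ≠ p` at once, class
level) for the ABSOLUTE corestriction `cores` that `coresShapiro` uses:

* §1 (any number field `K`, any `TopRep` `X` of `Γ_K`, any normal open `N` of finite index UNRAMIFIED at
  `v`, i.e. containing every inertia group above `v`): if a cocycle `f` on `N` vanishes on `N ∩ I_𝔓`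
  for EVERY prime `𝔓 ∣ v`, then the transfer cocycle `transferCocycle … f` (whose class is `cores [f]`)
  vanishes on `I_𝔓` for every `𝔓 ∣ v` (`transferCocycle_apply_eq_zero_of_forall_primesAbove`): for
  `g ∈ I_𝔓 ⊆ N`, `g` acts trivially on `Γ_K/N` and the Schreier element at `x` is `s(x)⁻¹ g s(x) ∈
  N ∩ I_{s(x)⁻¹𝔓}` (`Ideal.conj_mem_inertia_smul_iff`, `smul_mem_primesAbove`); class form
  `exists_cocycle_cores_apply_eq_zero_of_forall_primesAbove`, and with a coefficient morphism
  `φ : A ⟶ X|_N` in front (`…_cores_cohomologyMap_…`).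
* §2 the instance `coresShapiro`: for a `ℤ_p`-extension `κ₁` and `v ∤ p` the layer `Γ_n = κ₁.layerSubgroup n`
  is unramified at `v` (`subgroupIsUnramifiedAt_layerSubgroup`, from `ZpExtension.inertia_le_kerSubgroup_holds`),
  so **`exists_cocycle_coresShapiro_apply_eq_zero_of_forall_primesAbove`**: if a cocycle `f` of
  `y_n ∈ H¹(K_n, M)` vanishes on `Γ_n ∩ I_𝔓` for all `𝔓 ∣ v`, then `coresShapiro n [f] = [F]` for a cocycle
  `F` of `𝒯_{pⁿ}(ρ, κ₁)` vanishing on every `I_𝔓`, `𝔓 ∣ v` — in particular on the distinguished inertia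
  `res(I_{K_v})` (`inertia_adicCompletionPrime_eq_map_absInertia`), the input of the local criterion
  `X11b.LocBridge.mem_unramifiedSubgroup_one_iff_forall_eq_zero`.

What remains of (L-ur) for its hand (k6-c2 l.293 / plan g9 ACCEL-LIST l.291): the step `y ↦ y_n`
(fine ⟹ `y_n` vanishes on the inertia groups above `v`, which lie in `Gal(ℚ̄/ℚ_∞) ≤ Γ_n`: Castella
`resOfLe_torsion_eq_zero_of_forall_conjHmem_awayKer`-type + `inertia_le_kerSubgroup_holds`) and the
step `Y ↦ Ψ` (`T^k`, the `T`-embedding and its injectivity on inertia values).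

PARTITION (D-0054): X9 (A4) · X10∧¬Surj (A5) at `p = 3` (prime- and field-generic) — hypothesis-discharging
helper toward `stub_selmerDualOdd`; closes NONE.

References: J. Neukirch, A. Schmidt, K. Wingberg, *Cohomology of Number Fields* (2008) I §5 (1.5.7)
[NeukirchSchmidtWingberg2008]; K. Kato, Astérisque 295 (2004) §8.2, Lemma 8.5 [Kato2004Asterisque];
J.-P. Serre, *Galois Cohomology* (1997) I §2.5 [SerreGaloisCohomology1997]; adapted from the tree's
`Literature/NumberTheory/EllipticCurves/Kato2004/IntegralH1Corestriction.lean` (bsd-potss-rkm).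
-/

-- the summit and its single problem are both named `BirchSwinnertonDyer` (registry layout D-0017)
set_option linter.dupNamespace false

set_option autoImplicit false

noncomputable section

open scoped NumberField Pointwise
open CategoryTheory Field IsDedekindDomain NumberField
open Literature.NumberTheory.GaloisRepresentations
open Literature.NumberTheory.GaloisRepresentations.IsNonarchimedeanLocalField
open Literature.NumberTheory.EllipticCurves

universe u w

namespace Summit.BirchSwinnertonDyer.BirchSwinnertonDyer.Rank1Residual.CoresUnramified

/-! ### §1 The transfer cocycle vanishes on the inertia groups above an unramified place -/

section Transfer

variable {K : Type u} [Field K] [NumberField K] {R : Type w} [Ring R] [TopologicalSpace R]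
  (X : TopRep.{u} R (absoluteGaloisGroup K)) {N : Subgroup (absoluteGaloisGroup K)} [N.Normal]
  (hN : IsOpen (N : Set (absoluteGaloisGroup K))) [Fintype (absoluteGaloisGroup K ⧸ N)]

omit [NumberField K] [Fintype (absoluteGaloisGroup K ⧸ N)] in
/-- For `N` normal, an element of `N` acts trivially on `Γ_K ⧸ N`. [folklore] -/
private theorem smul_quotient_eq_self {g : absoluteGaloisGroup K} (hg : g ∈ N)
    (x : absoluteGaloisGroup K ⧸ N) : g • x = x := by
  induction x using QuotientGroup.induction_on with
  | H u =>
    rw [MulAction.Quotient.smul_mk, QuotientGroup.eq, smul_eq_mul]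
    have : (g * u)⁻¹ * u = u⁻¹ * g⁻¹ * u⁻¹⁻¹ := by group
    rw [this]
    exact Subgroup.Normal.conj_mem inferInstance _ (N.inv_mem hg) _

/-- **The transfer cocycle vanishes on every inertia group above `v`** when `N` is unramified at `v`
and the cocycle on `N` vanishes on `N ∩ I_𝔓` for EVERY prime `𝔓 ∣ v`: for `g ∈ I_𝔓 ⊆ N` the Schreier
element at the coset `x` is `s(x)⁻¹ g s(x) ∈ N ∩ I_{s(x)⁻¹ 𝔓}` (NSW (1.5.7), normal case).
[cite: NeukirchSchmidtWingberg2008, I §5 (1.5.6)–(1.5.7)] [cite: Kato2004Asterisque, §8.2 and Lemma 8.5 (pp. 180–184)] -/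
theorem transferCocycle_apply_eq_zero_of_forall_primesAbove
    {s : absoluteGaloisGroup K ⧸ N → absoluteGaloisGroup K}
    (hs : ∀ x, (s x : absoluteGaloisGroup K ⧸ N) = x) {v : HeightOneSpectrum (𝓞 K)}
    (hunr : SubgroupIsUnramifiedAt K N v) (f : contOneCocycles (subgroupRep X N))
    (hf : ∀ 𝔓 ∈ v.primesAbove, ∀ n : N,
      (n : absoluteGaloisGroup K) ∈ 𝔓.inertia (absoluteGaloisGroup K) → f.1 n = 0)
    {𝔓 : Ideal (absIntegers (𝓞 K) K)} (h𝔓 : 𝔓 ∈ v.primesAbove) {g : absoluteGaloisGroup K}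
    (hg : g ∈ 𝔓.inertia (absoluteGaloisGroup K)) :
    (transferCocycle X N hN hs f).1 g = 0 := by
  have hgN : g ∈ N := hunr 𝔓 h𝔓 hg
  rw [transferCocycle_apply, transferFun_apply]
  refine Finset.sum_eq_zero fun x _ => ?_
  have h1 : schreierElt N hs g x = subgroupConj N (s x) ⟨g, hgN⟩ :=
    schreierElt_coe_eq_subgroupConj N hs ⟨g, hgN⟩ x
  have hmem : ((subgroupConj N (s x) ⟨g, hgN⟩ : N) : absoluteGaloisGroup K) ∈
      ((s x)⁻¹ • 𝔓).inertia (absoluteGaloisGroup K) := by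
    rw [subgroupConj_apply_coe]
    have h := (Ideal.conj_mem_inertia_smul_iff 𝔓 (s x)⁻¹ g).mpr hg
    rwa [inv_inv] at h
  rw [h1, hf _ (smul_mem_primesAbove h𝔓 (s x)⁻¹) _ hmem, map_zero]

/-- **`cores [f]` has a cocycle vanishing on every `I_𝔓`, `𝔓 ∣ v`** (class form of the previous
theorem, representatives `Quotient.out`). [cite: NeukirchSchmidtWingberg2008, I §5 (1.5.6)–(1.5.7)] -/
theorem exists_cocycle_cores_apply_eq_zero_of_forall_primesAbove {v : HeightOneSpectrum (𝓞 K)}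
    (hunr : SubgroupIsUnramifiedAt K N v) (f : contOneCocycles (subgroupRep X N))
    (hf : ∀ 𝔓 ∈ v.primesAbove, ∀ n : N,
      (n : absoluteGaloisGroup K) ∈ 𝔓.inertia (absoluteGaloisGroup K) → f.1 n = 0) :
    ∃ F : contOneCocycles X, oneCocycleClass X F = cores X N hN (oneCocycleClass _ f) ∧
      ∀ 𝔓 ∈ v.primesAbove, ∀ g ∈ 𝔓.inertia (absoluteGaloisGroup K), F.1 g = 0 :=
  ⟨transferCocycle X N hN QuotientGroup.out_eq' f,
    (cores_oneCocycleClass X N hN QuotientGroup.out_eq' f).symm,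
    fun _ h𝔓 _ hg => transferCocycle_apply_eq_zero_of_forall_primesAbove X hN QuotientGroup.out_eq'
      hunr f hf h𝔓 hg⟩

/-- **With a coefficient morphism in front** (`cores ∘ H¹(φ)`, the shape of `coresShapiro`): if `f` on
`N` with values in `A` vanishes on `N ∩ I_𝔓` for all `𝔓 ∣ v`, then `cores (H¹(φ) [f])` has a cocycle
vanishing on every `I_𝔓`, `𝔓 ∣ v`. [cite: NeukirchSchmidtWingberg2008, I §5 (1.5.6)–(1.5.7)] -/
theorem exists_cocycle_cores_cohomologyMap_apply_eq_zero_of_forall_primesAbove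
    {A : TopRep.{u} R N} (φ : A ⟶ subgroupRep X N) {v : HeightOneSpectrum (𝓞 K)}
    (hunr : SubgroupIsUnramifiedAt K N v) (f : contOneCocycles A)
    (hf : ∀ 𝔓 ∈ v.primesAbove, ∀ n : N,
      (n : absoluteGaloisGroup K) ∈ 𝔓.inertia (absoluteGaloisGroup K) → f.1 n = 0) :
    ∃ F : contOneCocycles X,
      oneCocycleClass X F = cores X N hN (cohomologyMap φ 1 (oneCocycleClass _ f)) ∧
      ∀ 𝔓 ∈ v.primesAbove, ∀ g ∈ 𝔓.inertia (absoluteGaloisGroup K), F.1 g = 0 := by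
  rw [cohomologyMap_oneCocycleClass]
  exact exists_cocycle_cores_apply_eq_zero_of_forall_primesAbove X hN hunr _ fun 𝔓 h𝔓 n hn => by
    rw [pullback_id_resIdHom_apply, hf 𝔓 h𝔓 n hn, map_zero]

end Transfer

/-! ### §2 The layers of a `ℤ_p`-extension are unramified at `v ∤ p`; the instance `coresShapiro` -/

section Shapiro

variable {K : Type u} [Field K] [NumberField K] {p : ℕ} [Fact p.Prime] (κ₁ : ZpExtension K p)

/-- **`Γ_n = Gal(K̄/K_n)` is unramified at every `v ∤ p`**: the inertia groups above `v` lie in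
`Gal(K̄/K_∞) ≤ Gal(K̄/K_n)` (`ZpExtension.inertia_le_kerSubgroup_holds`, Washington Prop. 13.2).
[cite: Washington1997, Prop. 13.2] -/
theorem subgroupIsUnramifiedAt_layerSubgroup {v : HeightOneSpectrum (𝓞 K)}
    (hvp : (p : 𝓞 K) ∉ v.asIdeal) (n : ℕ) : SubgroupIsUnramifiedAt K (κ₁.layerSubgroup n) v :=
  fun _ h𝔓 => (ZpExtension.inertia_le_kerSubgroup_holds K p κ₁
    hvp h𝔓).trans (κ₁.kerSubgroup_le_layerSubgroup n)

/-- The same for `Gal(K̄/K_∞)`. [cite: Washington1997, Prop. 13.2] -/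
theorem subgroupIsUnramifiedAt_kerSubgroup {v : HeightOneSpectrum (𝓞 K)}
    (hvp : (p : 𝓞 K) ∉ v.asIdeal) : SubgroupIsUnramifiedAt K κ₁.kerSubgroup v :=
  fun _ h𝔓 => ZpExtension.inertia_le_kerSubgroup_holds K p κ₁
    hvp h𝔓

variable {M : Type u} [AddCommGroup M] [TopologicalSpace M] [DiscreteTopology M]
  (ρ : DiscreteGaloisModule K M) (hM : ∀ x : M, p • x = 0) (n : ℕ)
  [Fintype (absoluteGaloisGroup K ⧸ κ₁.layerSubgroup n)]

/-- **The inverse Shapiro map preserves "unramified at `v ∤ p`"** (the step `y_n ↦ Y = Sh⁻¹ y_n` of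
(L-ur)): if a cocycle `f` of `y_n ∈ H¹(K_n, M)` vanishes on `Γ_n ∩ I_𝔓` for every prime `𝔓 ∣ v`, then
`coresShapiro n [f] = [F]` for a cocycle `F` of `𝒯_{pⁿ}(ρ, κ₁)` over `Γ_K` vanishing on every `I_𝔓`,
`𝔓 ∣ v`. [cite: SerreGaloisCohomology1997, I §2.5 Prop. 10] [cite: NeukirchSchmidtWingberg2008, I §5 (1.5.6)–(1.5.7)] -/
theorem exists_cocycle_coresShapiro_apply_eq_zero_of_forall_primesAbove {v : HeightOneSpectrum (𝓞 K)}
    (hvp : (p : 𝓞 K) ∉ v.asIdeal)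
    (f : contOneCocycles (subgroupRep ρ.toTopRep (κ₁.layerSubgroup n)))
    (hf : ∀ 𝔓 ∈ v.primesAbove, ∀ g : κ₁.layerSubgroup n,
      (g : absoluteGaloisGroup K) ∈ 𝔓.inertia (absoluteGaloisGroup K) → f.1 g = 0) :
    ∃ F : contOneCocycles (κ₁.twistModP ρ hM (p ^ n)).toTopRep,
      oneCocycleClass _ F = κ₁.coresShapiro ρ hM n (oneCocycleClass _ f) ∧
      ∀ 𝔓 ∈ v.primesAbove, ∀ g ∈ 𝔓.inertia (absoluteGaloisGroup K), F.1 g = 0 :=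
  exists_cocycle_cores_cohomologyMap_apply_eq_zero_of_forall_primesAbove
    (κ₁.twistModP ρ hM (p ^ n)).toTopRep (κ₁.isOpen_layerSubgroup n) (κ₁.unitCoeffHom ρ hM n)
    (subgroupIsUnramifiedAt_layerSubgroup κ₁ hvp n) f hf

/-- **Corollary at the distinguished inertia**: the cocycle `F` of the previous theorem vanishes on
`res(I_{K_v})` (`= I_{𝔓₀}`, `inertia_adicCompletionPrime_eq_map_absInertia`) — the pointwise input of
the local criterion `X11b.LocBridge.mem_unramifiedSubgroup_one_iff_forall_eq_zero` for
`loc_v (coresShapiro n y_n)`. [cite: NeukirchANT1999, Ch. II §9 Prop. (9.6)] -/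
theorem exists_cocycle_coresShapiro_apply_absGaloisRestrict_eq_zero {v : HeightOneSpectrum (𝓞 K)}
    (hvp : (p : 𝓞 K) ∉ v.asIdeal)
    (f : contOneCocycles (subgroupRep ρ.toTopRep (κ₁.layerSubgroup n)))
    (hf : ∀ 𝔓 ∈ v.primesAbove, ∀ g : κ₁.layerSubgroup n,
      (g : absoluteGaloisGroup K) ∈ 𝔓.inertia (absoluteGaloisGroup K) → f.1 g = 0) :
    ∃ F : contOneCocycles (κ₁.twistModP ρ hM (p ^ n)).toTopRep,
      oneCocycleClass _ F = κ₁.coresShapiro ρ hM n (oneCocycleClass _ f) ∧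
      ∀ i ∈ absInertia (v.adicCompletion K), F.1 (absGaloisRestrict K (v.adicCompletion K) i) = 0 := by
  obtain ⟨F, hF, h0⟩ :=
    exists_cocycle_coresShapiro_apply_eq_zero_of_forall_primesAbove κ₁ ρ hM n hvp f hf
  refine ⟨F, hF, fun i hi => h0 _ (adicCompletionPrime_mem_primesAbove K v) _ ?_⟩
  rw [inertia_adicCompletionPrime_eq_map_absInertia]
  exact ⟨i, hi, rfl⟩

end Shapiro

end Summit.BirchSwinnertonDyer.BirchSwinnertonDyer.Rank1Residual.CoresUnramified

end
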